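import Mathlib.Analysis.SpecialFunctions.Pow.Real
import Mathlib.Analysis.SpecialFunctions.Sqrt
import Mathlib.Analysis.Complex.Basic
import HarnessLib

/-!
# Artin's inequality for units of complex cubic fields — the analytic core

Topic `Literature/NumberTheory/CubicFields`, namespace `Literature.NumberTheory.CubicFields.Artin`.
Everything here is PROVED (theorems only, standard axioms); no number theory yet — see
`ArtinUnitInequality.lean` for the theorem `|d_K| ≤ 4ε³ + 24`.

For a real `ε ≥ 1` and a complex `z` with `ε‖z‖² = 1` (the archimedean data of a unit `u` of a cubic field
with one real place: `σ₁ u = ε`, `σ₂ u = z`, `|N u| = ε|z|² = 1`), the absolute discriminant of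
`(1, u, u²)` is `|σ₁u − σ₂u|⁴ |σ₂u − σ̄₂u|² = ((ε − Re z)² + (Im z)²)² · 4 (Im z)²`; Artin's inequality bounds
it by `4ε³ + 24`.  Writing `ε = y²`, `x = y³`, `Re z = c/y` (`|c| ≤ 1`), the claim is the polynomial
inequality `(1 − c²)(x² − 2xc + 1)² ≤ x⁴ + 6x²` (`P_le`), proved through `ξ = x + 1/x ≥ 2`:
`x² − 2xc + 1 = x(ξ − 2c)`, `(1 − c²)(ξ − 2c)² ≤ ξ² + 4 − 4/ξ²` (`H_nonneg`, an explicit three-case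
certificate in `s = ξ·(−c)`), and `ξ² + 4 − 4/ξ² ≤ x² + 6`.

## References
* Ş. Alaca, K. S. Williams, *Introductory Algebraic Number Theory*, CUP (2004), proof of Theorem 13.6.1,
  pp. 275–277 (the trigonometric form of the same computation). [AlacaWilliams2003]
* D. A. Marcus, *Number Fields* (1977), Ch. 5, Exercise 35. [Marcus1977]
-/

noncomputable section

namespace Literature.NumberTheory.CubicFields

namespace Artin

/-! ### The analytic core -/

/-- `ξ⁴ + 4ξ² − 4 − ξ²(1−c²)(ξ−2c)² ≥ 0` for `ξ ≥ 2`, `|c| ≤ 1` (three-case elementary certificate).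
[folklore] -/
theorem H_nonneg {ξ c : ℝ} (hξ : 2 ≤ ξ) (hc1 : -1 ≤ c) (hc2 : c ≤ 1) :
    0 ≤ ξ ^ 4 + 4 * ξ ^ 2 - 4 - ξ ^ 2 * (1 - c ^ 2) * (ξ - 2 * c) ^ 2 := by
  have hξ0 : 0 ≤ ξ := by linarith
  have h1c : 0 ≤ 1 - c ^ 2 := by nlinarith
  rcases le_or_gt 0 c with hc | hc
  · have hid : ξ ^ 4 + 4 * ξ ^ 2 - 4 - ξ ^ 2 * (1 - c ^ 2) * (ξ - 2 * c) ^ 2 =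
        4 * ξ ^ 2 - 4 + 4 * ξ ^ 3 * c * (1 - c ^ 2) + ξ ^ 2 * c ^ 2 * (ξ ^ 2 - 4) + 4 * ξ ^ 2 * c ^ 4 := by
      ring
    rw [hid]
    have h2 : 0 ≤ ξ ^ 2 - 4 := by nlinarith
    have h3 : 0 ≤ 4 * ξ ^ 3 * c * (1 - c ^ 2) := by positivity
    have h4 : 0 ≤ ξ ^ 2 * c ^ 2 * (ξ ^ 2 - 4) := by positivity
    have h5 : 0 ≤ 4 * ξ ^ 2 * c ^ 4 := by positivity
    nlinarith
  · set t : ℝ := -c with ht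
    have hct : c = -t := by rw [ht]; ring
    have ht0 : 0 ≤ t := by linarith
    have ht1 : t ≤ 1 := by linarith
    rw [hct]
    have hid1 : ξ ^ 4 + 4 * ξ ^ 2 - 4 - ξ ^ 2 * (1 - (-t) ^ 2) * (ξ - 2 * (-t)) ^ 2 =
        ξ ^ 2 * (2 * t ^ 2 + ξ * t - 1) ^ 2 + 3 * ξ ^ 2 - 4 - 2 * ξ ^ 3 * t := by ring
    have hid2 : ξ ^ 4 + 4 * ξ ^ 2 - 4 - ξ ^ 2 * (1 - (-t) ^ 2) * (ξ - 2 * (-t)) ^ 2 =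
        ξ ^ 2 * (ξ * t - 2) ^ 2 + 4 * ξ ^ 2 * t ^ 4 + 4 * ξ ^ 3 * t ^ 3 - 4 * ξ ^ 2 * t ^ 2 - 4 := by ring
    set s : ℝ := ξ * t with hs
    have hs0 : 0 ≤ s := by positivity
    rcases le_or_gt s 1 with hs1 | hs1
    · rw [hid1]
      have hsq : 0 ≤ ξ ^ 2 * (2 * t ^ 2 + ξ * t - 1) ^ 2 := by positivity
      have h2 : 2 * ξ ^ 3 * t = 2 * ξ ^ 2 * s := by rw [hs]; ring
      rw [h2]
      nlinarith
    rcases le_or_gt s 2 with hs2 | hs2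
    · rw [hid2]
      have hamgm : 4 * ξ ^ 2 * t ^ 2 * (2 - ξ * t) ≤ ξ ^ 2 * (ξ * t - 2) ^ 2 + 4 * ξ ^ 2 * t ^ 4 := by
        nlinarith [sq_nonneg (ξ * (2 - ξ * t) - 2 * ξ * t ^ 2)]
      have h3 : 4 * ξ ^ 2 * t ^ 2 * (2 - ξ * t) + 4 * ξ ^ 3 * t ^ 3 - 4 * ξ ^ 2 * t ^ 2 - 4 =
          4 * (ξ * t) ^ 2 - 4 := by ring
      have h4 : 0 ≤ 4 * (ξ * t) ^ 2 - 4 := by rw [← hs]; nlinarith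
      linarith
    · rw [hid2]
      have hsq : 0 ≤ ξ ^ 2 * (ξ * t - 2) ^ 2 := by positivity
      have h4 : 0 ≤ 4 * ξ ^ 2 * t ^ 4 := by positivity
      have h5 : 4 * ξ ^ 3 * t ^ 3 - 4 * ξ ^ 2 * t ^ 2 - 4 = 4 * (ξ * t) ^ 2 * (ξ * t - 1) - 4 := by ring
      have h6 : 0 ≤ 4 * (ξ * t) ^ 2 * (ξ * t - 1) - 4 := by
        rw [← hs]; nlinarith
      linarith

/-- The polynomial heart: `(1 − c²)(x² − 2xc + 1)² ≤ x⁴ + 6x²` for `x ≥ 1`, `|c| ≤ 1` (via `ξ = x + 1/x`: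
`x² − 2xc + 1 = x(ξ − 2c)`, `H_nonneg`, and `ξ² + 4 − 4/ξ² ≤ x² + 6`). [folklore] -/
theorem P_le {x c : ℝ} (hx : 1 ≤ x) (hc1 : -1 ≤ c) (hc2 : c ≤ 1) :
    (1 - c ^ 2) * (x ^ 2 - 2 * x * c + 1) ^ 2 ≤ x ^ 4 + 6 * x ^ 2 := by
  have hx0 : 0 < x := by linarith
  set ξ : ℝ := x + 1 / x with hξ
  have hξ2 : 2 ≤ ξ := by
    rw [hξ]
    have : 0 ≤ (x - 1) ^ 2 / x := by positivity
    have h : x + 1 / x - 2 = (x - 1) ^ 2 / x := by field_simp; ring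
    linarith
  have hξ0 : 0 < ξ := by linarith
  have hfac : x ^ 2 - 2 * x * c + 1 = x * (ξ - 2 * c) := by rw [hξ]; field_simp; ring
  have hH := H_nonneg hξ2 hc1 hc2
  have h1 : (1 - c ^ 2) * (ξ - 2 * c) ^ 2 ≤ ξ ^ 2 + 4 - 4 / ξ ^ 2 := by
    have hξ20 : 0 < ξ ^ 2 := by positivity
    rw [show ξ ^ 2 + 4 - 4 / ξ ^ 2 = (ξ ^ 4 + 4 * ξ ^ 2 - 4) / ξ ^ 2 by field_simp]
    rw [le_div_iff₀ hξ20]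
    nlinarith
  have h2 : ξ ^ 2 + 4 - 4 / ξ ^ 2 ≤ x ^ 2 + 6 := by
    have hξx : ξ ≤ 2 * x := by
      rw [hξ]
      have : 1 / x ≤ x := by rw [div_le_iff₀ hx0]; nlinarith
      linarith
    have hξ2' : ξ ^ 2 = x ^ 2 + 2 + 1 / x ^ 2 := by rw [hξ]; field_simp; ring
    have h4 : 1 / x ^ 2 ≤ 4 / ξ ^ 2 := by
      rw [div_le_div_iff₀ (by positivity) (by positivity)]
      nlinarith
    linarith
  calc (1 - c ^ 2) * (x ^ 2 - 2 * x * c + 1) ^ 2 = x ^ 2 * ((1 - c ^ 2) * (ξ - 2 * c) ^ 2) := by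
        rw [hfac]; ring
    _ ≤ x ^ 2 * (x ^ 2 + 6) := mul_le_mul_of_nonneg_left (h1.trans h2) (by positivity)
    _ = x ^ 4 + 6 * x ^ 2 := by ring

/-- **Artin's inequality, analytic core**: for real `ε ≥ 1` and complex `z` with `ε ‖z‖² = 1`,
`((ε − Re z)² + (Im z)²)² · 4 (Im z)² ≤ 4ε³ + 24`. [cite: AlacaWilliams2003, Thm 13.6.1 (proof, p. 277)] -/
theorem artin_core {ε : ℝ} (hε : 1 ≤ ε) {z : ℂ} (hz : ε * (z.re ^ 2 + z.im ^ 2) = 1) :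
    ((ε - z.re) ^ 2 + z.im ^ 2) ^ 2 * (4 * z.im ^ 2) ≤ 4 * ε ^ 3 + 24 := by
  have hε0 : 0 < ε := by linarith
  set a : ℝ := z.re with ha
  set b : ℝ := z.im with hb
  set y : ℝ := Real.sqrt ε with hy
  have hy0 : 0 < y := Real.sqrt_pos.mpr hε0
  have hy1 : 1 ≤ y := by rw [hy]; exact Real.one_le_sqrt.mpr hε
  have hyy : y ^ 2 = ε := by rw [hy]; exact Real.sq_sqrt hε0.le
  set c : ℝ := a * y with hc
  set x : ℝ := y ^ 3 with hx
  have hx1 : 1 ≤ x := by rw [hx]; exact one_le_pow₀ hy1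
  have hb2 : b ^ 2 = 1 / ε - a ^ 2 := by
    field_simp
    linarith [hz]
  have hc2 : c ^ 2 ≤ 1 := by
    rw [hc, mul_pow, hyy]
    nlinarith [sq_nonneg b]
  have hcb : -1 ≤ c ∧ c ≤ 1 := by
    constructor <;> nlinarith [hc2, sq_nonneg (c + 1), sq_nonneg (c - 1)]
  have hP := P_le hx1 hcb.1 hcb.2
  have hε3 : ε ^ 3 = x ^ 2 := by rw [hx, ← hyy]; ring
  have hA : (ε - a) ^ 2 + b ^ 2 = (x ^ 2 - 2 * x * c + 1) / y ^ 2 := by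
    rw [hb2, hx, hc, ← hyy]
    field_simp
    ring
  have hB : 4 * b ^ 2 = 4 * (1 - c ^ 2) / y ^ 2 := by
    rw [hb2, hc, mul_pow, ← hyy]
    field_simp
  rw [hA, hB, hε3]
  have hy20 : 0 < y ^ 2 := by positivity
  rw [div_pow, div_mul_div_comm, div_le_iff₀ (by positivity)]
  have hy6 : (y ^ 2) ^ 2 * y ^ 2 = x ^ 2 := by rw [hx]; ring
  rw [hy6]
  have hx0 : 0 ≤ x ^ 2 := by positivity
  nlinarith [hP]

end Artin

end Literature.NumberTheory.CubicFields

end
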